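import Literature.IUT.HodgeArakelov.CohomologyLimitKummerAmbientRestrict
import Literature.IUT.HodgeArakelov.CohomologyAutKummerSemilinear
import Literature.IUT.HodgeArakelov.EtaleThetaDataOfSettingAutAction

/-!
# [IUTchII] Prop 3.1 (ii) / 3.4 (i) at the genuine data: the Π-INTRINSIC action of `α ∈ Aut_top(Π^tp_X̲̲)` carries the
# Kummer class of a constant `b` to the Kummer class of `e_α b` — binder (P3) from an isomorphism of MLF-pairs

abc-iut cell (WAVE-5 seat abc-iut-w5-d169; holder sub-row «P34i-GENUINE-(P1)» of DAG node IUTchII:Prop3.4(i),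
`plan/L6/SUBDAG-IUTchII-Prop-31-33-34.md`; GAP row G-w5d169-3).  S. Mochizuki, *Inter-universal Teichmüller theory II*,
kurims manuscript (Dec. 2020), Prop. 3.1 (ii) p. 88 («`Ψ_cns(M^Θ_*) := M_TM(M^Θ_*) ⊆ lim_J H¹(Π_Ÿ(M^Θ_*)|_J, Π_μ(M^Θ_*))` …
functorial»), Prop. 3.4 (i) p. 91 («compatible collections of isomorphisms … `M_TM ⥲ M_TM`»); *Topics in absolute
anabelian geometry III*, Prop. 3.2 (i), (ii), (iv) p. 71 (functoriality of `Π ↦ (Π ↷ M_TM(Π))` with its Kummer map in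
isomorphisms of topological groups).  Claim key `Mochizuki2012` (DISPUTED, D-0012); [EtTh] Cor. 2.18 (i) = F-0620, BY
NAME; classical Kummer theory [cite: NeukirchSchmidtWingberg2008, I §5].

WHAT IS PROVED (proof-only; no definitions, no `Prop`-valued fact), for abc-iut-w4-d007's Kummer map
`κ = h1LimKummer (phi C) (l·Δ_Θ) (Π^tp_Ÿ̲̲) c` of a discrete rootable `Π^tp_X̲̲`-module `A` (the constants `ℚ̄_pˣ ⊇ 𝒪^▷`
through `ε`, `EtaleThetaDataOfSettingGaloisUnits`) with cyclotome coefficients `c : Λ(A) → l·Δ_Θ`, and abc-iut-w5-d169's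
Π-intrinsic action `autAct` / `autActOfCor218i` (p428996):
* **`autAct_h1LimKummer_semilinear`** — `ρ_α (κ b) = κ (e b)` for every `α ∈ Aut_top(Π^tp_X̲̲)` (stabilising `Ker φ`,
  `φ⁻¹(l·Δ_Θ)`, `Π^tp_Ÿ̲̲`) and every **semilinear automorphism `e` of the constants over `α`** (`x • e a = e (α⁻¹x • a)`)
  **compatible with the cyclotomic rigidity** (`c(Λ(e) ζ) = rangeAut α (c ζ)` in `φ(Π^tp_X̲̲)`): abc-iut-w5-d169's generic
  `h1LimAut_h1LimKummer_semilinear` (p432910) at the restricted ambient, transported by `ContH1Restrict.limEquiv_h1LimKummer`;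
* `map_mrange_h1LimKummerOn_eq_of_autAct_semilinear` — hence `ρ_α` carries `Ψ_cns = κ(O)` onto itself for every
  `e`-stable submonoid `O` (the constant monoid);
* **`exists_equivariant_h1LimKummerOn_of_semilinear`** — the hypothesis `hequiv` of abc-iut-w5-d169's
  `EtaleLevels.prop34i_multiradiallyDefined_ofRootHypEquiv` (p432788) for THIS `κ` follows from the existence, for every
  `α`, of such an `(e_α)` — GAP row G-w5d169-3 in its final, print-shaped form ([AbsTopIII] Prop 3.2: `α` induces an
  isomorphism of the MLF-pair `(Π^tp_X̲̲ ↷ 𝒪^▷)` compatible with the cyclotomic rigidity isomorphism).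
Nothing here takes a side on [IUTchIII] Cor. 3.12; typed ≠ proved.
-/

noncomputable section

open Topology

namespace Literature.IUT.HodgeArakelov

namespace EtaleThetaDataOfSetting

open Literature.AnabelianGeometry.EtaleTheta CohomologySystemOfContH1

/-- Image stability from equivariance (generic; local copy of the private helper of `ThetaEnvDataRecordAutOfRootHyp`). [folklore] -/
private theorem mrange_map_eq_of_equivariant' {M X : Type*} [Monoid M] [Monoid X] (κ : M →* X) (f : X ≃* X)
    (e : M ≃* M) (h : ∀ m, f (κ m) = κ (e m)) : (MonoidHom.mrange κ).map (f : X →* X) = MonoidHom.mrange κ := by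
  ext y
  constructor
  · rintro ⟨_, ⟨m, rfl⟩, rfl⟩
    exact ⟨e m, (h m).symm⟩
  · rintro ⟨m, rfl⟩
    refine ⟨κ (e.symm m), ⟨e.symm m, rfl⟩, ?_⟩
    change f (κ (e.symm m)) = κ m
    rw [h, MulEquiv.apply_symm_apply]

variable {p : ℕ} [Fact p.Prime] {D : Literature.AnabelianGeometry.EtaleTheta.ThetaSetting p}
  {E : D.EtaleThetaData} {l : ℕ} (C : E.DoubleUnderline l) (hq : IsQuotientMap D.toTheta)
  {A : Type} [CommGroup A] [MulDistribMulAction (Pi C) A] [TopologicalSpace A] [RootableBy A ℕ]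
  (c : CyclotomeCoefficients (phi C) (D.lDeltaTheta l) A)
  (hopen : ∀ b : A, IsOpen (MulAction.stabilizer (Pi C) b : Set (Pi C)))
  (hfi : ∀ b : A, (MulAction.stabilizer (Pi C) b).FiniteIndex)

/-! ### 1. For a bare `α` stabilising `Ker φ`, `φ⁻¹(l·Δ_Θ)`, `Π^tp_Ÿ̲̲` -/

section Act

variable (α : (Pi C) ≃ₜ* (Pi C)) (hker : ∀ x, x ∈ (phi C).ker ↔ α x ∈ (phi C).ker)
  (hA : ∀ x, x ∈ (D.lDeltaTheta l).comap (phi C) ↔ α x ∈ (D.lDeltaTheta l).comap (phi C))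
  (hH : ∀ x, x ∈ PiYdd C ↔ α x ∈ PiYdd C)
  (e : A ≃* A) (he : ∀ (x : Pi C) (a : A), x • e a = e (α.symm x • a))
  (hc : ∀ ζ : cyclotome A, ((c.hom (cyclotome.map e.toMonoidHom ζ) : D.lDeltaTheta l) : D.GtpTheta) =
    ((rangeAut C α hker hq ⟨(c.hom ζ : D.GtpTheta), lDeltaTheta_le_phiRange C (c.hom ζ).2⟩ : phiRange C) : D.GtpTheta))

omit [RootableBy A ℕ] in
include hc in
/-- The cyclotome compatibility read at the restricted ambient `φ(Π^tp_X̲̲)`. [cite: Mochizuki2012, Prop 3.1 (ii) p.88] -/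
theorem coeffRestrict_compat (ζ : cyclotome A) :
    ((((ContH1Restrict.coeffRestrict (phi C) (D.lDeltaTheta l) (phiRange C) (phi_mem_phiRange C)
        (lDeltaTheta_le_phiRange C) c).hom (cyclotome.map e.toMonoidHom ζ) :
          (D.lDeltaTheta l).subgroupOf (phiRange C)) : phiRange C) : phiRange C) =
      rangeAut C α hker hq
        ((ContH1Restrict.coeffRestrict (phi C) (D.lDeltaTheta l) (phiRange C) (phi_mem_phiRange C)
          (lDeltaTheta_le_phiRange C) c).hom ζ : phiRange C) :=
  Subtype.ext (hc ζ)

include he hc in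
/-- **`ρ_α (κ b) = κ (e b)`**: the Π-intrinsic action of `α` carries the Kummer class of every constant `b` to the Kummer
class of `e b`, for a semilinear `e` over `α` compatible with the cyclotomic rigidity. [cite: Mochizuki2012, Prop 3.1 (ii) p.88] -/
theorem autAct_h1LimKummer_semilinear (b : A) :
    autAct C hq α hker hA hH (Multiplicative.toAdd (h1LimKummer (phi C) (D.lDeltaTheta l) (PiYdd C) c hopen hfi b)) =
      Multiplicative.toAdd (h1LimKummer (phi C) (D.lDeltaTheta l) (PiYdd C) c hopen hfi (e b)) := by
  apply (limRestrict C).injective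
  rw [limRestrict_autAct, ContH1Restrict.limEquiv_h1LimKummer, ContH1Restrict.limEquiv_h1LimKummer]
  exact h1LimAut_h1LimKummer_semilinear (phiR C) ((D.lDeltaTheta l).subgroupOf (phiRange C)) (PiYdd C)
    (ContH1Restrict.coeffRestrict (phi C) (D.lDeltaTheta l) (phiRange C) (phi_mem_phiRange C)
      (lDeltaTheta_le_phiRange C) c)
    α (rangeAut C α hker hq) (rangeAut_phiR C α hker hq) (mem_lDeltaTheta_iff_rangeAut C α hker hq hA) hH e he
    (coeffRestrict_compat C hq c α hker e hc) hopen hfi b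

include he hc in
/-- Multiplicative form: `toMultiplicative ρ_α (κ b) = κ (e b)`. [cite: Mochizuki2012, Prop 3.1 (ii) p.88] -/
theorem toMultiplicative_autAct_h1LimKummer_semilinear (b : A) :
    AddEquiv.toMultiplicative (autAct C hq α hker hA hH) (h1LimKummer (phi C) (D.lDeltaTheta l) (PiYdd C) c hopen hfi b) =
      h1LimKummer (phi C) (D.lDeltaTheta l) (PiYdd C) c hopen hfi (e b) :=
  congrArg Multiplicative.ofAdd (autAct_h1LimKummer_semilinear C hq c hopen hfi α hker hA hH e he hc b)

include he hc in
/-- **(P3) for the Kummer image of an `e`-stable submonoid**: `ρ_α` carries `κ(O) = Ψ_cns` ONTO itself.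
[cite: Mochizuki2012, Prop 3.4 (i) p.91] -/
theorem map_mrange_h1LimKummerOn_eq_of_autAct_semilinear (O : Submonoid A) (hO : ∀ a, a ∈ O ↔ e a ∈ O) :
    (MonoidHom.mrange (h1LimKummerOn (phi C) (D.lDeltaTheta l) (PiYdd C) c hopen hfi O)).map
        (AddEquiv.toMultiplicative (autAct C hq α hker hA hH) :
          Multiplicative (h1Lim (phi C) (D.lDeltaTheta l) (PiYdd C) ⊥) →*
            Multiplicative (h1Lim (phi C) (D.lDeltaTheta l) (PiYdd C) ⊥)) =
      MonoidHom.mrange (h1LimKummerOn (phi C) (D.lDeltaTheta l) (PiYdd C) c hopen hfi O) := by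
  rw [mrange_h1LimKummerOn]
  ext y
  constructor
  · rintro ⟨_, ⟨a, ha, rfl⟩, rfl⟩
    exact ⟨e a, (hO a).mp ha,
      (toMultiplicative_autAct_h1LimKummer_semilinear C hq c hopen hfi α hker hA hH e he hc a).symm⟩
  · rintro ⟨a, ha, rfl⟩
    refine ⟨h1LimKummer (phi C) (D.lDeltaTheta l) (PiYdd C) c hopen hfi (e.symm a), ⟨e.symm a, ?_, rfl⟩, ?_⟩
    · exact (hO _).mpr (by rw [MulEquiv.apply_symm_apply]; exact ha)
    · change AddEquiv.toMultiplicative (autAct C hq α hker hA hH)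
          (h1LimKummer (phi C) (D.lDeltaTheta l) (PiYdd C) c hopen hfi (e.symm a)) = _
      rw [toMultiplicative_autAct_h1LimKummer_semilinear C hq c hopen hfi α hker hA hH e he hc, MulEquiv.apply_symm_apply]

end Act

/-! ### 2. For EVERY `α` (F-0620): the hypothesis `hequiv` of `prop34i_multiradiallyDefined_ofRootHypEquiv` -/

section FromCor218i

variable {N : ℕ+} (μ : D.CyclotomeMod l N) (hC : D.Compat) (hS : D.Sec2Hyps) (h15 : D.Prop15iii E hC)
  (L : C.CuspLabels) (R : RigidData.{0} N l) (hR : R = C.rigidData μ hC hS h15 L) (h218i : R.Cor218_i)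

/-- The restriction of an `O`-stable automorphism `e` of `A` to the submonoid `O`. [cite: Mochizuki2012, Prop 3.1 (ii) p.88] -/
private def restrictEquiv (e : A ≃* A) (O : Submonoid A) (hO : ∀ a, a ∈ O ↔ e a ∈ O) : O ≃* O where
  toFun m := ⟨e (m : A), (hO (m : A)).mp m.2⟩
  invFun m := ⟨e.symm (m : A), (hO _).mpr (by rw [MulEquiv.apply_symm_apply]; exact m.2)⟩
  left_inv m := Subtype.ext (e.symm_apply_apply (m : A))
  right_inv m := Subtype.ext (e.apply_symm_apply (m : A))
  map_mul' m m' := Subtype.ext (map_mul e (m : A) (m' : A))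

/-- **`hequiv` for the genuine constant-monoid Kummer map from isomorphisms of MLF-pairs**: if for every topological
automorphism `α` of `Π^tp_X̲̲` there is a semilinear automorphism `e_α` of the constants over `α`, compatible with the
cyclotomic rigidity (`c(Λ(e_α) ζ) = rangeAut α (c ζ)`) and carrying the constant monoid `O` onto itself ([AbsTopIII] Prop.
3.2 functoriality — GAP row G-w5d169-3 in print's shape), then `κ = h1LimKummerOn c O` intertwines `ρ_α` with SOME
automorphism of `O` for every `α` — the hypothesis `hequiv` of abc-iut-w5-d169's `prop34i_multiradiallyDefined_ofRootHypEquiv`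
at this `κ`. [cite: Mochizuki2012, Prop 3.4 (i) p.91] -/
theorem exists_equivariant_h1LimKummerOn_of_semilinear (O : Submonoid A)
    (hsemi : ∀ α : (Pi C) ≃ₜ* (Pi C), ∃ e : A ≃* A,
      (∀ (x : Pi C) (a : A), x • e a = e (α.symm x • a)) ∧
      (∀ ζ : cyclotome A, ((c.hom (cyclotome.map e.toMonoidHom ζ) : D.lDeltaTheta l) : D.GtpTheta) =
        ((rangeAutOfCor218i C μ hq hC hS h15 L R hR h218i α
          ⟨(c.hom ζ : D.GtpTheta), lDeltaTheta_le_phiRange C (c.hom ζ).2⟩ : phiRange C) : D.GtpTheta)) ∧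
      (∀ a, a ∈ O ↔ e a ∈ O))
    (α : (Pi C) ≃ₜ* (Pi C)) :
    ∃ e' : O ≃* O, ∀ m : O,
      AddEquiv.toMultiplicative (autActOfCor218i C hq μ hC hS h15 L R hR h218i α)
          (h1LimKummerOn (phi C) (D.lDeltaTheta l) (PiYdd C) c hopen hfi O m) =
        h1LimKummerOn (phi C) (D.lDeltaTheta l) (PiYdd C) c hopen hfi O (e' m) := by
  obtain ⟨e, he, hc, hO⟩ := hsemi α
  refine ⟨restrictEquiv e O hO, fun m => ?_⟩
  exact toMultiplicative_autAct_h1LimKummer_semilinear C hq c hopen hfi α _ _ _ e he hc (m : A)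

/-- Consequently `ρ_α` carries `Ψ_cns = κ(O)` onto itself for EVERY `α` — binder (P3) `hκ` of abc-iut-w5-d169's
`prop34i_multiradiallyDefined_ofInversion` / `_ofRootHyp` at the genuine Kummer map, from the [AbsTopIII] Prop. 3.2-shaped
input `hsemi`. [cite: Mochizuki2012, Prop 3.4 (i) p.91] -/
theorem map_mrange_h1LimKummerOn_eq_of_semilinear (O : Submonoid A)
    (hsemi : ∀ α : (Pi C) ≃ₜ* (Pi C), ∃ e : A ≃* A,
      (∀ (x : Pi C) (a : A), x • e a = e (α.symm x • a)) ∧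
      (∀ ζ : cyclotome A, ((c.hom (cyclotome.map e.toMonoidHom ζ) : D.lDeltaTheta l) : D.GtpTheta) =
        ((rangeAutOfCor218i C μ hq hC hS h15 L R hR h218i α
          ⟨(c.hom ζ : D.GtpTheta), lDeltaTheta_le_phiRange C (c.hom ζ).2⟩ : phiRange C) : D.GtpTheta)) ∧
      (∀ a, a ∈ O ↔ e a ∈ O))
    (α : (Pi C) ≃ₜ* (Pi C)) :
    (MonoidHom.mrange (h1LimKummerOn (phi C) (D.lDeltaTheta l) (PiYdd C) c hopen hfi O)).map
        (AddEquiv.toMultiplicative (autActOfCor218i C hq μ hC hS h15 L R hR h218i α) :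
          Multiplicative (h1Lim (phi C) (D.lDeltaTheta l) (PiYdd C) ⊥) →*
            Multiplicative (h1Lim (phi C) (D.lDeltaTheta l) (PiYdd C) ⊥)) =
      MonoidHom.mrange (h1LimKummerOn (phi C) (D.lDeltaTheta l) (PiYdd C) c hopen hfi O) := by
  obtain ⟨e', he'⟩ := exists_equivariant_h1LimKummerOn_of_semilinear C hq c hopen hfi μ hC hS h15 L R hR h218i O hsemi α
  exact mrange_map_eq_of_equivariant' _ _ e' he'

end FromCor218i

end EtaleThetaDataOfSetting

end Literature.IUT.HodgeArakelov

end
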